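/-
Copyright (c) 2026 the pub-hodgecm-mathlib formalisation cell (harness21).  Prover seat hodgecm-mathlib-K2E3-p14 (g10) (E3 hand on strike line L1; LEAD F0P6-plan (g15)
BATCH #226 «(F-tail-arch) road END TO END», default follow-on 01:41:52Z), Track B «K2-LIT» ∕ hLiu418 = `stmt-HodgeConjecture-24832`: U1-glob LEVEL 2-fin, the ARCH-KERNEL
branch — (F-split-arch): the FACES SPLIT of the FINITE head `HT_f` of ★ (F-tail-arch) FILE 4 p864223 for ★ (F-rest) at `Tw := T` (the arch twin of ★ p864130
`K2LiuLocalKernelHeadSplitAtKernelPlace`).  THEOREMS ONLY (no `def` ∕ `instance` ∕ notation ∕ named-fact hypothesis ∕ `sorry`).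
-/
import Summits.HodgeConjecture.HodgeConjecture.Theorems.K2LiuLocalKernelHeadSplitAtKernelPlace    -- ★ (F-split) p864130 (K2E3-p28): brings ★ (E10a), ★ (E6′), ★ (E9), ★ `K2LiuBigCellLocalFace` letters, ★ Fubini
import HarnessLib

/-!
# Crux `HLiu418`, U1-glob LEVEL 2-fin, arch-kernel branch — (F-split-arch) `K2LiuLocalKernelArchHeadSplit`: THE FACES SPLIT OF THE FINITE HEAD AT AN ARCHIMEDEAN KERNEL PLACE
# `HT_f(s,h′) = Σ_{i<m} c_i(s) · ∏_{v∈T} ∫_{N_Δ(L⁺_v)} conj ψ_S(ι_v y) · G_{i,v,s}((w_Δ)_v y h′_v) dν_v(y)` on `{1 < re s}`, `c_i` ENTIRE   [KudlaRallis1994 §2; Tan1999 §3; HKS1996 §6]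

Cell `hodgecm-mathlib`, crux item hLiu418 = `stmt-HodgeConjecture-24832`; squad K2, strike line L1, LEAD F0P6-plan (g15); END pen K2E3-p32 (g3) (FILE B, the consumer);
prover K2E3-p14 (g10).  Lane `--supports stmt-HodgeConjecture-24832 --as helper` (count-neutral).  THEOREMS ONLY.  The CM doubled datum at rank `n = 2` (frame
`e : Fin N × Fin M ≃ Fin 2`, ★ (E9)'s currency); general index `S`, base parameter `s₀`, point `h′`.

THE POINT.  ★ (F-rest) `K2LiuLocalKernelClearedRestAtKernelPlace.exists_clearedRest_kernelPlace` takes the FACES SPLIT `hsplit` of a head `HT` — arch coefficients `A i` with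
continuations `Ac i` and the local letters `(K₀ hK₀ hIw G hSieg hsm hflat)` of its finite faces — BY VALUE; ★ (F-tail-arch) FILE 4 `exists_archKernel_tailPackage` exports the FINITE
head `HT_f` only as the integral over `⨂_{v∈T} ν_v` of the opaque rest `rT` (`hHT`) with the arch purity clause `hpure : f_s ∘ placesEmbed_T = bA ⊗ rT`.  This file derives the split —
the arch twin of ★ (F-split), and SIMPLER: (1) ★ (E10a) `exists_isStd_adaptedEverywhere`: a standard `𝒦⁺ ⊇ 𝒦` STILL CARRYING `f` with a compact open Iwasawa `K₀ v`, `ι_v(K₀ v) ⊆ 𝒦⁺.K`,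
at every place; (2) ★ (E6′) `exists_awayPurity_flat` at `𝒦⁺`: off a finite `S₀`, `f_s ∘ placesEmbed_T = Σ_{i<m} (H⁺_∞^{2(s−s₀)}A_i) ⊗ ⊗_{v∈T} (H⁺_v^{2(s−s₀)} b_{i,v})` with the five letters;
(3) dividing by the ARCH factor `bA s y₀ = t^{2(s−s₀)}·d ≠ 0` (a point `y₀` of the arch block where the kernel section does not vanish): `rT_s` is the finite sum of PURE FINITE tensors
`Σ_i c_i(s)·⊗_{v∈T}(H⁺_v^{…}b_{i,v})` with ENTIRE SCALAR coefficients `c_i(s) = (t^{2(s−s₀)}d)⁻¹ · H⁺_∞(y₀)^{2(s−s₀)} A_i(y₀)` — NO archimedean function survives; (4) Fubini on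
`⨂_{v∈T} ν_v` ALONE (§0, Mathlib `integral_finsetSum` + `integral_fintype_prod_eq_prod`) with the finite integrability letters ★ (E9) `integrable_weylDelta_mul_unipDeltaLoc_cm` (`1 < re s`)
— NO archimedean integrability letter (contrast ★ (F-split)'s `hAint`); (5) the local letters of `G_{i,v} = H⁺_v^{2(s−s₀)} b_{i,v}` by ★ `heightTwistLoc_siegel ∕ _smooth ∕ _flat`, the local
Iwasawa letter by ★ `hIw_local`, and `Finset.prod_coe_sort` to read `∏ v : T` as `∏ v ∈ T`.  So ★ (F-rest)'s arch coefficients at an arch kernel place are the ENTIRE SCALARS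
`A i = Ac i := c_i` (`hAc` = differentiability, `hA` = `rfl`): FILE B's arch branch needs NO arch continuation letter for the rest.
* §0 `integral_pi_eq_sum_const_mul_prod` — Fubini for a sum of constant × pure finite tensors on `Measure.pi`.
* §1 **`exists_archHeadSplit`**.
References: [KudlaRallis1994] §1–§2; [Tan1999] §1 p. 166, §3; [HarrisKudlaSweet1996] §1 (1.15)–(1.17), §6 (6.14)–(6.16); [KudlaSweet1997] §1; [BorelJacquet1979] §4.1;
[Casselman1980] §3 Thm. 3.1.
HONEST LABEL.  Count-neutral helper: `HC_CM` is proved only modulo the 7 printed citations (2 remaining named inputs: hLiu418 = `stmt-HodgeConjecture-24832`, h413 =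
`stmt-HodgeConjecture-24833`) until rung 0 closes; LEVEL 2 stays OPEN (FILE B; the arch reading `hloc` + `hdead∞` by value).
-/

set_option autoImplicit false
set_option linter.dupNamespace false -- the mandated namespace repeats `HodgeConjecture.HodgeConjecture`

noncomputable section

open scoped Matrix RestrictedProduct ENNReal NNReal Topology ComplexConjugate
open NumberField IsDedekindDomain MeasureTheory Measure Filter Set

namespace Summit.HodgeConjecture.HodgeConjecture.Cruxes.HLiu418.K2LiuLocalKernelArchHeadSplit

open Literature.NumberTheory.Automorphic Literature.NumberTheory.GaloisRepresentations
open Literature.NumberTheory.GelbartRogawski1991 Literature.NumberTheory.GelbartRogawski1991.GRConstruction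
open Literature.NumberTheory.GelbartRogawski1991.UnitaryDualPair
open Literature.NumberTheory.K2Lit.SiegelDoubled Literature.NumberTheory.K2Lit.LocalSiegelDoubled
open Literature.NumberTheory.K2Lit.PlaceSplitting
open Summit.HodgeConjecture.HodgeConjecture.Cruxes.HLiu418.K2LiuSiegelUnipotentLocalDefs
open Summit.HodgeConjecture.HodgeConjecture.Cruxes.HLiu418.K2LiuSiegelUnipotentSplitDefs
open Summit.HodgeConjecture.HodgeConjecture.Cruxes.HLiu418.K2LiuSiegelUnipotentSplitAtDefs
open Summit.HodgeConjecture.HodgeConjecture.Cruxes.HLiu418.K2LiuSiegelUnipotentFourierDefs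
open Summit.HodgeConjecture.HodgeConjecture.Cruxes.HLiu418.K2LiuSiegelUnipotentCharacters (continuous_unipDeltaChar)
open Summit.HodgeConjecture.HodgeConjecture.Cruxes.HLiu418.K2LiuStdDatumFinsetAdapted (exists_isStd_adaptedEverywhere)
open Summit.HodgeConjecture.HodgeConjecture.Cruxes.HLiu418.K2LiuStdFamilyAwayPurityFlat (exists_awayPurity_flat heightTwistLoc_siegel heightTwistLoc_smooth differentiable_heightTwist)
open Summit.HodgeConjecture.HodgeConjecture.Cruxes.HLiu418.K2LiuBigCellLocalFace (hIw_local heightTwistLoc_flat)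
open Summit.HodgeConjecture.HodgeConjecture.Cruxes.HLiu418.K2LiuLocalSiegelSectionIntegrable (integrable_weylDelta_mul_unipDeltaLoc_cm)

/-! ## §0 Fubini for a sum of constant × pure finite tensors on `Measure.pi` -/

/-- **`∫ Φ d(⨂_v ν_v) = Σ_i c_i · ∏_v ∫ G_{i,v} dν_v`** when `Φ q = Σ_i c_i · ∏_v G_{i,v}(q v)` pointwise and every `G_{i,v} ∈ L¹(ν_v)` (Mathlib `integral_finsetSum`,
`Integrable.fintype_prod_dep`, `integral_fintype_prod_eq_prod`). [cite: Tan1999, §3] [cite: BorelJacquet1979, §4.1] -/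
theorem integral_pi_eq_sum_const_mul_prod {ι : Type*} [Fintype ι] {Y : ι → Type*} [∀ v, MeasurableSpace (Y v)] (ν : ∀ v, Measure (Y v)) [∀ v, SigmaFinite (ν v)]
    {κ : Type*} (I : Finset κ) (c : κ → ℂ) (G : κ → ∀ v, Y v → ℂ) (hG : ∀ i ∈ I, ∀ v, Integrable (G i v) (ν v))
    (Φ : (∀ v, Y v) → ℂ) (hΦ : ∀ q, Φ q = ∑ i ∈ I, c i * ∏ v, G i v (q v)) :
    ∫ q, Φ q ∂(Measure.pi ν) = ∑ i ∈ I, c i * ∏ v, ∫ y, G i v y ∂(ν v) := by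
  rw [show Φ = fun q => ∑ i ∈ I, c i * ∏ v, G i v (q v) from funext hΦ,
    integral_finsetSum _ (fun i hi => (Integrable.fintype_prod_dep (hG i hi)).const_mul (c i))]
  exact Finset.sum_congr rfl fun i _ => by rw [integral_const_mul, integral_fintype_prod_eq_prod]

/-! ## §1 The faces split of the finite head -/

variable (L : Type) [Field L] [NumberField L] [IsCMField L]
variable {N M : ℕ} (e : Fin N × Fin M ≃ Fin 2)
  (dV : Fin N → L) (hdV : ∀ i, IsCMField.complexConj L (dV i) = dV i)
  (dW : Fin M → L) (hdW : ∀ i, IsCMField.complexConj L (dW i) = dW i)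
  [DecidableEq (HeightOneSpectrum (𝓞 (Fp L)))]
  [∀ v : HeightOneSpectrum (𝓞 (Fp L)), MeasurableSpace ↥(unipDeltaLoc L e dV hdV dW hdW v)] [∀ v : HeightOneSpectrum (𝓞 (Fp L)), BorelSpace ↥(unipDeltaLoc L e dV hdV dW hdW v)]

set_option maxHeartbeats 2400000 in -- MEASURED class of ★ (F-split) p864130 (statement `whnf` 800 000 ✗; Fubini `isDefEq` 1 600 000 ✗; 2 400 000 ✓ there)
/-- **(F-split-arch) THE FACES SPLIT OF THE FINITE HEAD AT AN ARCHIMEDEAN KERNEL PLACE.**  `𝒦` standard, `f := stdExtension 𝒦 s₀ φ` `𝒦`-standard with continuous members, `χ_v`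
unitary at every place.  THEN off a finite `S₀`: for every `T ⊇ S₀`, every arch factor `bA` with `bA s y₀ = t^{2(s−s₀)}·d` (`t > 0`, `d ≠ 0`) at some point `y₀` of the arch block,
every rest `rT` with ★ (F-tail-arch) FILE 4's purity clause `hpure`, all Haar carriers `ν_v`, every index `S`, point `h′` and finite head `HT` with ★ FILE 4's `hHT`:
`∃ m c K₀ G` — ENTIRE scalar faces `c i`, compact open Iwasawa `K₀ v` on `T`, local families `G i v s ∈ I_v(s, χ_v)` smooth and `K₀ v`-flat — with
`HT s h′ = Σ_i c i s · ∏_{v ∈ T} ∫ conj ψ_S(ι_v y)·G i v s ((w_Δ)_v·y·h′_v) dν_v(y)` on `{1 < re s}` (★ (F-rest)'s `hsplit` at `I := univ`, `Tw := T`, `hpt v := h′_v`, `A i = Ac i := c i`).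
[cite: KudlaRallis1994, §1–§2] [cite: Tan1999, §1 p. 166; §3] [cite: HarrisKudlaSweet1996, §1 (1.15)–(1.17); §6 (6.14)–(6.16)] [cite: KudlaSweet1997, §1] [cite: BorelJacquet1979, §4.1]
[cite: Casselman1980, §3 Thm. 3.1] -/
theorem exists_archHeadSplit (hdV0 : ∀ i, dV i ≠ 0) (hdW0 : ∀ i, dW i ≠ 0)
    {𝒦 : IwasawaDatum L e dV hdV dW hdW} (h𝒦 : 𝒦.IsStd) {χ : HeckeCharacter L}
    (hχ1 : ∀ (v : HeightOneSpectrum (𝓞 (Fp L))) (w' : UnitaryGroup.PlacesOver L v) (x : (w'.1.adicCompletion L)ˣ), ‖((χ.localComponent w'.1 x : ℂˣ) : ℂ)‖ = 1)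
    (s₀ : ℂ) {φ : HA L e dV hdV dW hdW → ℂ}
    (hstd : IsStandardSectionFamily 𝒦 χ (stdExtension 𝒦 s₀ φ)) (hcont : ∀ s, Continuous (stdExtension 𝒦 s₀ φ s)) :
    ∃ S₀ : Finset (HeightOneSpectrum (𝓞 (Fp L))), ∀ (T : Finset (HeightOneSpectrum (𝓞 (Fp L)))), S₀ ⊆ T → ∀
      (bA : ℂ → UnitaryGroup.arch (Fp L) L (IsCMField.complexConj L) (2 + 2) (hermD L e dV hdV dW hdW) → ℂ) (y₀ : UnitaryGroup.arch (Fp L) L (IsCMField.complexConj L) (2 + 2) (hermD L e dV hdV dW hdW)) (t : ℝ) (_ht : 0 < t) (d : ℂ) (_hd : d ≠ 0)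
      (_hbA : ∀ s : ℂ, bA s y₀ = ((t : ℝ) : ℂ) ^ (2 * (s - s₀)) * d)
      (rT : ℂ → (Π v : T, UnitaryGroup.localPi L (IsCMField.complexConj L) (2 + 2) (hermD L e dV hdV dW hdW) v.1) → ℂ)
      (_hpure : ∀ (s : ℂ) (yi : UnitaryGroup.arch (Fp L) L (IsCMField.complexConj L) (2 + 2) (hermD L e dV hdV dW hdW)) (y : Π v : T, UnitaryGroup.localPi L (IsCMField.complexConj L) (2 + 2) (hermD L e dV hdV dW hdW) v.1),
        stdExtension 𝒦 s₀ φ s (placesEmbed L (hermD L e dV hdV dW hdW) T (yi, y)) = bA s yi * rT s y)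
      (νv : ∀ v : HeightOneSpectrum (𝓞 (Fp L)), Measure ↥(unipDeltaLoc L e dV hdV dW hdW v)) [∀ v, (νv v).IsHaarMeasure] [∀ v, SigmaFinite (νv v)]
      (S : Matrix (Fin 2) (Fin 2) L) (h' : HA L e dV hdV dW hdW) (HT : ℂ → HA L e dV hdV dW hdW → ℂ)
      (_hHT : ∀ (s : ℂ) (h'' : HA L e dV hdV dW hdW), HT s h'' =
        ∫ q, (∏ v : T, conj (unipDeltaChar L e dV hdV dW hdW S
              (locToAdelic L e dV hdV dW hdW v.1 ((q v : ↥(unipDeltaLoc L e dV hdV dW hdW v.1)) : UnitaryGroup.localPi L (IsCMField.complexConj L) (2 + 2) (hermD L e dV hdV dW hdW) v.1)) : ℂ)) *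
          rT s (fun v : T => UnitaryGroup.evalPlace (Fp L) L (IsCMField.complexConj L) (2 + 2) (hermD L e dV hdV dW hdW) v.1 (UnitaryGroup.finPart (Fp L) L (IsCMField.complexConj L) (2 + 2) (hermD L e dV hdV dW hdW) (weylDelta L e dV hdV dW hdW)) *
                ((q v : ↥(unipDeltaLoc L e dV hdV dW hdW v.1)) : UnitaryGroup.localPi L (IsCMField.complexConj L) (2 + 2) (hermD L e dV hdV dW hdW) v.1) * UnitaryGroup.evalPlace (Fp L) L (IsCMField.complexConj L) (2 + 2) (hermD L e dV hdV dW hdW) v.1 (UnitaryGroup.finPart (Fp L) L (IsCMField.complexConj L) (2 + 2) (hermD L e dV hdV dW hdW) h''))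
          ∂(Measure.pi fun v : T => νv v.1)),
      ∃ (m : ℕ) (c : Fin m → ℂ → ℂ) (K₀ : ∀ v : HeightOneSpectrum (𝓞 (Fp L)), Subgroup (UnitaryGroup.localPi L (IsCMField.complexConj L) (2 + 2) (hermD L e dV hdV dW hdW) v))
        (G : Fin m → ∀ v : HeightOneSpectrum (𝓞 (Fp L)), ℂ → UnitaryGroup.localPi L (IsCMField.complexConj L) (2 + 2) (hermD L e dV hdV dW hdW) v → ℂ),
        (∀ i, Differentiable ℂ (c i)) ∧
        (∀ v ∈ T, IsCompact (K₀ v : Set (UnitaryGroup.localPi L (IsCMField.complexConj L) (2 + 2) (hermD L e dV hdV dW hdW) v)) ∧ IsOpen (K₀ v : Set (UnitaryGroup.localPi L (IsCMField.complexConj L) (2 + 2) (hermD L e dV hdV dW hdW) v))) ∧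
        (haveI : Algebra.IsQuadraticExtension (Fp L) L := IsCMField.isQuadraticExtension L
          ∀ v ∈ T, ∀ g : UnitaryGroup.localPi L (IsCMField.complexConj L) (2 + 2) (hermD L e dV hdV dW hdW) v,
            ∃ p, LocalSplitting.IsSiegelDelta (Fp L) L (IsCMField.complexConj L) (complexConj_imagUnit L) (imagUnit_ne_zero L) (imagUnit_mul_self L)
              v 2 (gramR_isSymm L e dV hdV dW hdW) (hermD_eq_map_gramD L e dV hdV dW hdW) p ∧ ∃ k ∈ K₀ v, g = p * k) ∧
        (haveI : Algebra.IsQuadraticExtension (Fp L) L := IsCMField.isQuadraticExtension L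
          ∀ i, ∀ v ∈ T, ∀ s, IsLocalSiegelSection (Fp L) L (IsCMField.complexConj L) (complexConj_imagUnit L) (imagUnit_ne_zero L) (imagUnit_mul_self L)
            v 2 (gramR_isSymm L e dV hdV dW hdW) (hermD_eq_map_gramD L e dV hdV dW hdW) (fun w : UnitaryGroup.PlacesOver L v => χ.localComponent w.1) s (G i v s)) ∧
        (∀ i, ∀ v ∈ T, ∀ s, IsSmooth (Fp L) L (IsCMField.complexConj L) v 2 (G i v s)) ∧
        (∀ i, ∀ v ∈ T, ∀ s s' : ℂ, ∀ k ∈ K₀ v, G i v s k = G i v s' k) ∧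
        ∀ s : ℂ, 1 < s.re → HT s h' = ∑ i, c i s * ∏ v ∈ T,
          ∫ y : ↥(unipDeltaLoc L e dV hdV dW hdW v), conj ((unipDeltaChar L e dV hdV dW hdW S
                (locToAdelic L e dV hdV dW hdW v (y : UnitaryGroup.localPi L (IsCMField.complexConj L) (2 + 2) (hermD L e dV hdV dW hdW) v)) : ℂ)) *
              G i v s (UnitaryGroup.evalPlace (Fp L) L (IsCMField.complexConj L) (2 + 2) (hermD L e dV hdV dW hdW) v (UnitaryGroup.finPart (Fp L) L (IsCMField.complexConj L) (2 + 2) (hermD L e dV hdV dW hdW) (weylDelta L e dV hdV dW hdW)) *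
                (y : UnitaryGroup.localPi L (IsCMField.complexConj L) (2 + 2) (hermD L e dV hdV dW hdW) v) * UnitaryGroup.evalPlace (Fp L) L (IsCMField.complexConj L) (2 + 2) (hermD L e dV hdV dW hdW) v (UnitaryGroup.finPart (Fp L) L (IsCMField.complexConj L) (2 + 2) (hermD L e dV hdV dW hdW) h')) ∂(νv v) := by
  classical
  haveI hq : Algebra.IsQuadraticExtension (Fp L) L := IsCMField.isQuadraticExtension L
  -- ★ (E10a): the everywhere-adapted standard datum `𝒦⁺ ⊇ 𝒦` still carrying `f`, with compact open Iwasawa `K₀ v`, `ι_v(K₀ v) ⊆ 𝒦⁺.K`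
  obtain ⟨𝒦', h𝒦', hle, hstd', hK₀⟩ := exists_isStd_adaptedEverywhere L e dV hdV hdV0 dW hdW hdW0 h𝒦 hstd hcont
  choose K₀ hK₀c hK₀o hIw hK₀K using hK₀
  -- ★ (E6′) at `𝒦⁺`
  obtain ⟨S₀, hS₀⟩ := exists_awayPurity_flat L e dV hdV hdV0 dW hdW hdW0 h𝒦' hstd' hcont s₀
  refine ⟨S₀, ?_⟩
  intro T hS₀T bA y₀ t ht d hd hbA rT hpure νv _ _ S h' HT hHT
  obtain ⟨-, -, m, b, A, hb, -, -, -, -, hslice⟩ := hS₀ T hS₀T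
  -- the local flat families `G i v s = H⁺_v^{2(s−s₀)} b_{i,v}` and the ENTIRE scalar coefficients `c i`
  obtain ⟨G, hG⟩ : ∃ G : Fin m → ∀ v : HeightOneSpectrum (𝓞 (Fp L)), ℂ → UnitaryGroup.localPi L (IsCMField.complexConj L) (2 + 2) (hermD L e dV hdV dW hdW) v → ℂ,
      G = fun i v s u => ((modDelta L e dV hdV dW hdW (𝒦'.pPart (locToAdelic L e dV hdV dW hdW v u)) : ℝ) : ℂ) ^ (2 * (s - s₀)) * b i v u := ⟨_, rfl⟩
  obtain ⟨c, hc⟩ : ∃ c : Fin m → ℂ → ℂ, c = fun i s => (((t : ℝ) : ℂ) ^ (2 * (s - s₀)) * d)⁻¹ *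
      (((modDelta L e dV hdV dW hdW (𝒦'.pPart (UnitaryGroup.archToAdelic (Fp L) L (IsCMField.complexConj L) (2 + 2) (hermD L e dV hdV dW hdW) y₀)) : ℝ) : ℂ) ^ (2 * (s - s₀)) * A i y₀) := ⟨_, rfl⟩
  have hne : ∀ s : ℂ, ((t : ℝ) : ℂ) ^ (2 * (s - s₀)) * d ≠ 0 := fun s =>
    mul_ne_zero (fun h0 => (Complex.ofReal_ne_zero.2 ht.ne') ((Complex.cpow_eq_zero_iff _ _).1 h0).1) hd
  -- (3) PURITY OF THE REST: `rT_s = Σ_i c_i(s) · ⊗_{v∈T} G_{i,v}(s)` — pure FINITE tensors with scalar coefficients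
  have hrT : ∀ (s : ℂ) (z : Π v : T, UnitaryGroup.localPi L (IsCMField.complexConj L) (2 + 2) (hermD L e dV hdV dW hdW) v.1), rT s z = ∑ i, c i s * ∏ v : T, G i v.1 s (z v) := by
    intro s z
    have h1 := hpure s y₀ z
    rw [hbA s] at h1
    have h2 := hslice s y₀ z
    have h3 : ∀ i : Fin m,
        (∏ v : T, (((modDelta L e dV hdV dW hdW (𝒦'.pPart (locToAdelic L e dV hdV dW hdW v.1 (z v))) : ℝ) : ℂ) ^ (2 * (s - s₀)) * b i v.1 (z v))) =
          ∏ v : T, G i v.1 s (z v) := fun i => Finset.prod_congr rfl fun v _ => by rw [hG]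
    calc rT s z = (((t : ℝ) : ℂ) ^ (2 * (s - s₀)) * d)⁻¹ * ((((t : ℝ) : ℂ) ^ (2 * (s - s₀)) * d) * rT s z) := by
          rw [inv_mul_cancel_left₀ (hne s)]
      _ = (((t : ℝ) : ℂ) ^ (2 * (s - s₀)) * d)⁻¹ * stdExtension 𝒦 s₀ φ s (placesEmbed L (hermD L e dV hdV dW hdW) T (y₀, z)) := by rw [h1]
      _ = ∑ i, c i s * ∏ v : T, G i v.1 s (z v) := by
          rw [h2, Finset.mul_sum]
          refine Finset.sum_congr rfl fun i _ => ?_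
          rw [h3 i, hc]
          ring
  -- the translated arguments and the integrand family
  obtain ⟨Y, hY⟩ : ∃ Y : ∀ v : T, ↥(unipDeltaLoc L e dV hdV dW hdW v.1) → UnitaryGroup.localPi L (IsCMField.complexConj L) (2 + 2) (hermD L e dV hdV dW hdW) v.1,
      Y = fun v y => UnitaryGroup.evalPlace (Fp L) L (IsCMField.complexConj L) (2 + 2) (hermD L e dV hdV dW hdW) v.1 (UnitaryGroup.finPart (Fp L) L (IsCMField.complexConj L) (2 + 2) (hermD L e dV hdV dW hdW) (weylDelta L e dV hdV dW hdW)) * (y : UnitaryGroup.localPi L (IsCMField.complexConj L) (2 + 2) (hermD L e dV hdV dW hdW) v.1) * UnitaryGroup.evalPlace (Fp L) L (IsCMField.complexConj L) (2 + 2) (hermD L e dV hdV dW hdW) v.1 (UnitaryGroup.finPart (Fp L) L (IsCMField.complexConj L) (2 + 2) (hermD L e dV hdV dW hdW) h') := ⟨_, rfl⟩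
  obtain ⟨ψv, hψv⟩ : ∃ ψv : ∀ v : T, ↥(unipDeltaLoc L e dV hdV dW hdW v.1) → ℂ,
      ψv = fun v y => (conj (unipDeltaChar L e dV hdV dW hdW S (locToAdelic L e dV hdV dW hdW v.1 (y : UnitaryGroup.localPi L (IsCMField.complexConj L) (2 + 2) (hermD L e dV hdV dW hdW) v.1))) : ℂ) := ⟨_, rfl⟩
  have hψvc : ∀ v, Continuous (ψv v) := fun v => by
    rw [hψv]
    have hloc : Continuous (locToAdelic L e dV hdV dW hdW v.1) :=
      UnitaryGroup.continuous_inclPlaceAdelic (Fp L) L (IsCMField.complexConj L) (2 + 2) (hermD L e dV hdV dW hdW) v.1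
    exact Complex.continuous_conj.comp ((continuous_unipDeltaChar L e dV hdV dW hdW S).comp (hloc.comp continuous_subtype_val))
  have hψv1 : ∀ v y, ‖ψv v y‖ ≤ 1 := fun v y => by rw [hψv, Complex.norm_conj, Circle.norm_coe]
  refine ⟨m, c, K₀, G, fun i => ?_, fun v _ => ⟨hK₀c v, hK₀o v⟩, fun v _ => hIw_local L e dV hdV dW hdW v (hIw v), fun i v hv s => ?_, fun i v hv s => ?_,
    fun i v _ s s' k hk => ?_, fun s hs => ?_⟩
  · -- `c i` is entire
    rw [hc]
    exact ((differentiable_heightTwist ht s₀ d).inv hne).mul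
      (differentiable_heightTwist (modDelta_pos L e dV hdV dW hdW _) s₀ (A i y₀))
  · -- Siegel law of `G i v s`
    rw [hG]
    exact heightTwistLoc_siegel L e dV hdV hdV0 dW hdW hdW0 v 𝒦' (hb i v hv) s
  · -- smoothness of `G i v s`
    rw [hG]
    exact heightTwistLoc_smooth L e dV hdV hdV0 dW hdW hdW0 v h𝒦' (hb i v hv).2 _
  · -- flatness on `K₀ v`
    rw [hG]
    exact heightTwistLoc_flat L e dV hdV hdV0 dW hdW hdW0 v 𝒦' (hK₀K v) s₀ (b i v) s s' k hk
  · -- THE SPLIT at `s`, `1 < re s`: §0 Fubini over `⨂_{v∈T} ν_v` with ★ (E9)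
    have hGint : ∀ i ∈ (Finset.univ : Finset (Fin m)), ∀ v : T,
        Integrable (fun y : ↥(unipDeltaLoc L e dV hdV dW hdW v.1) => ψv v y * G i v.1 s (Y v y)) (νv v.1) := by
      intro i _ v
      have hbase : Integrable (fun y : ↥(unipDeltaLoc L e dV hdV dW hdW v.1) => G i v.1 s (Y v y)) (νv v.1) := by
        rw [hG, hY]
        exact integrable_weylDelta_mul_unipDeltaLoc_cm L e dV hdV hdV0 dW hdW hdW0 v.1 (νv v.1) (hχ1 v.1) hs
          (heightTwistLoc_siegel L e dV hdV hdV0 dW hdW hdW0 v.1 𝒦' (hb i v.1 v.2) s)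
          (heightTwistLoc_smooth L e dV hdV hdV0 dW hdW hdW0 v.1 h𝒦' (hb i v.1 v.2).2 _) _
      exact hbase.bdd_mul (hψvc v).aestronglyMeasurable (Filter.Eventually.of_forall (hψv1 v))
    have key := integral_pi_eq_sum_const_mul_prod (fun v : T => νv v.1) (Finset.univ : Finset (Fin m)) (fun i => c i s)
      (fun i v y => ψv v y * G i v.1 s (Y v y)) hGint
      (fun q => (∏ v : T, ψv v (q v)) * rT s (fun v => Y v (q v)))
      (fun q => by
        rw [hrT s, Finset.mul_sum]
        refine Finset.sum_congr rfl fun i _ => ?_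
        rw [Finset.prod_mul_distrib]
        ring)
    have hHT' : HT s h' = ∫ q, (∏ v : T, ψv v (q v)) * rT s (fun v => Y v (q v)) ∂(Measure.pi fun v : T => νv v.1) := by
      rw [hHT s h', hψv, hY]
    rw [hHT', key]
    refine Finset.sum_congr rfl fun i _ => ?_
    congr 1
    rw [← Finset.prod_coe_sort T]
    refine Finset.prod_congr rfl fun v _ => ?_
    rw [hψv, hY]

end Summit.HodgeConjecture.HodgeConjecture.Cruxes.HLiu418.K2LiuLocalKernelArchHeadSplit

end
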